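import Summits.BirchSwinnertonDyer.BirchSwinnertonDyer.Theorems.SignedLowerHalvesSmallImageLowerHalfBothSignsRttD2SeqJ3CoeffPairing
import Summits.BirchSwinnertonDyer.BirchSwinnertonDyer.Theorems.SignedLowerHalvesSmallImageLowerHalfBothSignsRttD2SeqJ3Levelwise
import HarnessLib

/-!
# Route `SignedLowerHalves`, crux L `SmallImageLowerHalfBothSigns` (stmt-BirchSwinnertonDyer-23599), line `rtt_w3` v14 → v15 — E2, row J3 (Galois side):
# THE CORRECT FINITE-LEVEL FORM OF THE RECIPROCITY INPUT — over `k`-COMPATIBLE STRICT SEQUENCES at a fixed layer `n` — and J3 (generic `M` and the LEAD's `M = Cofree θ F`) from it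

WIDTH seat `bsd-line-slh-p3-w3` g22 under LEAD `cruxlead-stmt-BirchSwinnertonDyer-23599` g11 (cell `bsd-ssimc`); helper `--supports stmt-BirchSwinnertonDyer-23599`. THEOREMS ONLY.
HONEST FRAMING — A CORRECTION OF RECORD: the hypothesis `R` of `exists_junction_exact_of_levelwise` (p790532) / `exists_junction_exact_cofree` quantifies over ALL strict classes
`y ∈ Str_{n,k}` and ALL torsion-level lifts `ℓ` of `loc_{v,n} c`; for a `y` that does not lift to level `k′ ≫ k` and `ℓ ∈ δ(H⁰(K_{n,v}, M)/p^k) = ker(H¹(M[p^k]) → H¹(M))` the value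
`⟨loc y, ℓ⟩ = ±⟨∂y, m⟩` need NOT vanish (local duality `H²(T*) × H⁰(M)`), so that `R` is in general NOT dischargeable. The inputs actually used (`hrecL`) only concern `y = proj_{n,k} b`,
which lift to every `k′`. This file states the reciprocity over `k`-compatible strict sequences `(y_k)_k` at layer `n` (`RSeq` — equivalent to the `T*`-coefficient statement at `K_n`,
which IS the Poitou–Tate sum formula) and re-derives J3 from it; use THESE forms (`…_of_levelwiseSeq`, `…_cofree_seq`), not the `R`-forms. E2, crux L/M, BSD remain OPEN.

* ★ `hrecL_of_levelwiseSeq`, ★★★ `exists_junction_exact_of_levelwiseSeq` (generic `M`, coefficient pairings as inputs), ★★★ `exists_junction_exact_cofree_seq` (`M = Cofree θ F`,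
  `Pk := cofreeCoeffPairing`): J3 modulo `RSeq` + `hsolL` (+ side conditions).
References: [NeukirchSchmidtWingberg2008] VIII §6, (7.2.6), (7.2.12) (boundary compatibility); [Rubin2000] Thm. 1.7.3, §4.2; [Kobayashi2003] Thm. 7.3 i); [Kato2004Asterisque] §17.13.
-/

set_option autoImplicit false
set_option linter.dupNamespace false -- D-0017: single-problem summit, the namespace repeats the problem name by design
noncomputable section

open scoped Classical
open NumberField IsDedekindDomain Field Matrix

namespace Summit.BirchSwinnertonDyer.BirchSwinnertonDyer.Theorems.SmallImageRttD2Seq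

open Literature.NumberTheory.EllipticCurves Literature.NumberTheory.EllipticCurves.Kobayashi2003 Literature.NumberTheory.EllipticCurves.GreenbergSelmer
  Literature.NumberTheory.EllipticCurves.GreenbergVatsal2000 Literature.NumberTheory.GaloisRepresentations Literature.NumberTheory.GaloisCohomology
  Literature.NumberTheory.ComplexMultiplication.EllipticUnits.JohnsonLeungKings2011
  Summit.BirchSwinnertonDyer.BirchSwinnertonDyer.Theorems.SmallImageCharSignedSelmer
  Summit.BirchSwinnertonDyer.BirchSwinnertonDyer.Theorems.SmallImageRttD2J1

section Seq

variable {K : Type} [Field K] [NumberField K] {p : ℕ} [Fact p.Prime] {κ : ZpExtension K p} {γ : absoluteGaloisGroup K}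
  (S : Set (PadicAlgCl p)) [FiniteDimensional ℚ_[p] (padicCoeffField S)]
  {M : Type} [AddCommGroup M] [DistribMulAction (absoluteGaloisGroup K) M] [TopologicalSpace M] [DiscreteTopology M]
  [Module (padicCoeffIntegers S) M] [SMulCommClass (absoluteGaloisGroup K) (padicCoeffIntegers S) M]
  {V : WeierstrassCurve K} {j : V.geomPrimaryTorsion p →+ M} {S₀ : Set (HeightOneSpectrum (𝓞 K))} {ε : ℤˣ}
  (D : SignedTransportDualDataSat κ γ M (padicCoeffIntegers S) V j S₀ ε)
  {v : HeightOneSpectrum (𝓞 K)} [DistribMulAction (absoluteGaloisGroup (v.adicCompletion K)) M]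
  [SMulCommClass (absoluteGaloisGroup (v.adicCompletion K)) (padicCoeffIntegers S) M]
  {γv : absoluteGaloisGroup (v.adicCompletion K)} (DQ : LocalCondDualData κ M (padicCoeffIntegers S) V j ε v γv)
  (hres : ∀ (σ : absoluteGaloisGroup (v.adicCompletion K)) (m : M), σ • m = resGalOfEmb (closureEmb (K := K) (v.adicCompletion K)) σ • m)
  (hvp : (p : 𝓞 K) ∈ v.asIdeal)
  {γB : absoluteGaloisGroup K} {θ' : absoluteGaloisGroup K →ₜ* (padicCoeffIntegers S)ˣ} {P : Set (HeightOneSpectrum (𝓞 K))}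
  (I : CycIwasawaCohomologyDataO S κ γB θ' P 1)
  (hstab : ∀ m : M, IsOpen (MulAction.stabilizer (absoluteGaloisGroup (v.adicCompletion K)) m : Set (absoluteGaloisGroup (v.adicCompletion K))))
  (Pk : ∀ k : ℕ, ContPairing (locCoeffRep S θ' P v k).toTopRep (torsRep M hstab p k).toTopRep (muAt K (p ^ k) v).toTopRep)
  (htor : ∀ m : M, ∃ k : ℕ, p ^ k • m = 0)
  (hγB : γB * resGalOfEmb (closureEmb (K := K) (v.adicCompletion K)) γv ∈ κ.kerSubgroup)
  (hNP : ∀ n, ramificationSubgroup K P ≤ κ.layerSubgroup n) (hv : AcSigned.IsNonsplitIn κ v)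
  (hPred : ∀ (k : ℕ) (x : ↥(Representation.invariants ((muTwistO S θ' (k + 1)).toRepresentation.comp (ramificationSubgroup K P).subtype))) (m : ↥(torsionPow M p k)),
    (Pk (k + 1)).toLin x (AddSubgroup.inclusion (torsionPow_mono (M := M) (p := p) (Nat.le_succ k)) m) =
      muInclusion K (pow_dvd_pow p (Nat.le_succ k)) ((Pk k).toLin (coeffMapO S P θ' (oMuRed S k) (oMuRed_muTwistO S θ' k) x) m))
  (hPsc : ∀ (k : ℕ) (a : padicCoeffIntegers S) (x : ↥(Representation.invariants ((muTwistO S θ' k).toRepresentation.comp (ramificationSubgroup K P).subtype)))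
    (m : ↥(torsionPow M p k)), (Pk k).toLin (coeffMapO S P θ' (oMuScalar S (p ^ k) a) (oMuScalar_muTwistO S θ' k a) x) m = (Pk k).toLin x (a • m))

omit [FiniteDimensional ℚ_[p] (padicCoeffField S)] [SMulCommClass (absoluteGaloisGroup K) (padicCoeffIntegers S) M] in
/-- ★ **`hrecL` FROM THE RECIPROCITY OVER `k`-COMPATIBLE STRICT SEQUENCES**: if for every layer `n` and every sequence `(y_k)_k`, `y_k ∈ Str_{n,k}`, `red y_{k+1} = y_k`, the pairing
`⟨y_k, ℓ⟩_{n,k}` vanishes on every torsion-level lift `ℓ` of `loc_{v,n} c`, `c ∈ Sel^{ε,S₀}_𝒪(K_n, M)`, then the layer pairings of every strict norm-compatible family kill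
`loc_{v,n}(Sel)` (the families `k ↦ proj_{n,k} b` are such sequences, pin (P2)). [cite: NeukirchSchmidtWingberg2008, VIII §6] [cite: Rubin2000, Thm. 1.7.3] -/
theorem hrecL_of_levelwiseSeq
    (RSeq : ∀ (n : ℕ) (y : ∀ k : ℕ, cycLayerCohO S κ θ' P n k 1), (∀ k, y k ∈ strictLevel S κ θ' P S₀ n k) →
      (∀ k, cycLayerRedO S κ θ' P n k 1 (y (k + 1)) = y k) →
      ∀ (k : ℕ) (ℓ : subgroupH1 (localSubgroupOfEmb (κ.layerSubgroup n) (closureEmb (K := K) (v.adicCompletion K))) ↥(torsionPow M p k))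
        (c : subgroupH1 (κ.layerSubgroup n) M), c ∈ signedTransportSelmerLayerSat κ M (padicCoeffIntegers S) V j S₀ ε n →
        torsToH1 M p _ k ℓ = locH1Layer κ M v hres n c → locPairNK S κ θ' P v M hstab Pk n k (y k) ℓ = 0)
    (n : ℕ) (b : I.H) (hb : ∀ n k : ℕ, I.proj n k b ∈ strictLevel S κ θ' P S₀ n k) (c : subgroupH1 (κ.layerSubgroup n) M)
    (hc : c ∈ signedTransportSelmerLayerSat κ M (padicCoeffIntegers S) V j S₀ ε n) :
    (layerPairingOf S κ θ' P v M hstab Pk htor γB γv hγB hNP hv hPred hPsc).pairLayer n b (locH1Layer κ M v hres n c) = 0 := by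
  haveI : CompactSpace (absoluteGaloisGroup (v.adicCompletion K)) := absoluteGaloisGroup_compactSpace _
  haveI : CompactSpace ↥(localSubgroupOfEmb (κ.layerSubgroup n) (closureEmb (K := K) (v.adicCompletion K))) :=
    isCompact_iff_compactSpace.mp (isClosed_localLayer κ v n).isCompact
  obtain ⟨k, ℓ, hℓ⟩ := exists_torsToH1_eq _ htor (locH1Layer κ M v hres n c)
  rw [← hℓ, pairLayer_layerPairingOf_eq]
  exact RSeq n (fun k ↦ I.proj n k b) (hb n) (fun k ↦ I.proj_red n k b) k ℓ c hc hℓ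

/-- ★★★ **J3 FROM THE RECIPROCITY OVER `k`-COMPATIBLE STRICT SEQUENCES AND THE SOLVABILITY** (generic `M`, coefficient pairings as inputs): `exists_junction_exact_of_inputs` (p790304)
with `hrecL := hrecL_of_levelwiseSeq RSeq`. [cite: Kobayashi2003, Thm. 7.3 i)] [cite: Rubin2000, Thm. 1.7.3] [cite: NeukirchSchmidtWingberg2008, VIII §6] -/
theorem exists_junction_exact_of_levelwiseSeq (instX : Module (IwasawaAlgebraO S) D.X) (instQ : Module (IwasawaAlgebraO S) DQ.X)
    (hιX : ∀ (f : IwasawaAlgebra p) (x : D.X), (letI := instX; iwasawaToIwasawaO S f • x) = f • x)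
    (hιQ : ∀ (f : IwasawaAlgebra p) (x : DQ.X), (letI := instQ; iwasawaToIwasawaO S f • x) = f • x)
    (hCX : ∀ (a : padicCoeffIntegers S) (x : D.X) (s : signedTransportSelmerInftySat κ M (padicCoeffIntegers S) V j S₀ ε),
      D.toDual (letI := instX; (PowerSeries.C a : IwasawaAlgebraO S) • x) s =
        D.toDual x ⟨GreenbergSelmer.scalarH1 κ.kerSubgroup M a s, scalarH1_mem_signedTransportSelmerInftySat κ M (padicCoeffIntegers S) V j S₀ ε a s.2⟩)
    (hCQ : ∀ (a : padicCoeffIntegers S) (x : DQ.X) (c : localCondInftySat κ M (padicCoeffIntegers S) V j ε v),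
      DQ.toDual (letI := instQ; (PowerSeries.C a : IwasawaAlgebraO S) • x) c = DQ.toDual x (scalarLocalSat κ M (padicCoeffIntegers S) V j ε v a c))
    (hstabK : ∀ m : M, IsOpen (MulAction.stabilizer (absoluteGaloisGroup K) m : Set (absoluteGaloisGroup K)))
    (hγ : κ.IsTopGenerator γ) (hγv : κ.IsTopGenerator (resGalOfEmb (closureEmb (K := K) (v.adicCompletion K)) γv)) (hP : P.Finite)
    (RSeq : ∀ (n : ℕ) (y : ∀ k : ℕ, cycLayerCohO S κ θ' P n k 1), (∀ k, y k ∈ strictLevel S κ θ' P S₀ n k) →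
      (∀ k, cycLayerRedO S κ θ' P n k 1 (y (k + 1)) = y k) →
      ∀ (k : ℕ) (ℓ : subgroupH1 (localSubgroupOfEmb (κ.layerSubgroup n) (closureEmb (K := K) (v.adicCompletion K))) ↥(torsionPow M p k))
        (c : subgroupH1 (κ.layerSubgroup n) M), c ∈ signedTransportSelmerLayerSat κ M (padicCoeffIntegers S) V j S₀ ε n →
        torsToH1 M p _ k ℓ = locH1Layer κ M v hres n c → locPairNK S κ θ' P v M hstab Pk n k (y k) ℓ = 0)
    (hsolL : ∀ q : localCondInftySat κ M (padicCoeffIntegers S) V j ε v →+ AddCircle (1 : ℚ),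
      (∀ s : signedTransportSelmerInftySat κ M (padicCoeffIntegers S) V j S₀ ε, q (locSat κ M (padicCoeffIntegers S) V j S₀ ε v hres hvp s) = 0) →
      ∀ m : ℕ, ∃ y ∈ strictLevel S κ θ' P S₀ m m,
        ∀ (ℓ : subgroupH1 (localSubgroupOfEmb (κ.layerSubgroup m) (closureEmb (K := K) (v.adicCompletion K))) ↥(torsionPow M p m))
          (hℓ : ℓ ∈ goodLevel S κ v M V j ε m m), locPairNK S κ θ' P v M hstab Pk m m y ℓ = q ⟨_, hℓ⟩) :
    letI := instX; letI := instQ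
    ∃ j₀ : strictCarrier I (strictLevel S κ θ' P S₀) (fun n k f _ hy ↦ smul_mem_strictLevel S κ θ' P S₀ γB n k f hy) →ₗ[IwasawaAlgebraO S] DQ.X,
      (∀ b, DQ.toDual (j₀ b) = strictPairing (layerPairingOf S κ θ' P v M hstab Pk htor γB γv hγB hNP hv hPred hPsc) I (strictLevel S κ θ' P S₀)
        (fun n k f _ hy ↦ smul_mem_strictLevel S κ θ' P S₀ γB n k f hy) hstab b) ∧
      Function.Exact j₀ (gXLinearMapO S D DQ hres hvp instX instQ hιX hιQ hCX hCQ htor hstabK hstab hγ hv hγv) :=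
  exists_junction_exact_of_inputs S D DQ hres hvp I hstab Pk instX instQ hιX hιQ hCX hCQ htor hstabK hγ hv hγv hγB hNP hP hPred hPsc
    (hrecL_of_levelwiseSeq S hres I hstab Pk htor hγB hNP hv hPred hPsc RSeq) hsolL

end Seq

section CofreeSeq

variable {K : Type} [Field K] [NumberField K] {p : ℕ} [Fact p.Prime] {κ : ZpExtension K p} {γ : absoluteGaloisGroup K}
  (S : Set (PadicAlgCl p)) [FiniteDimensional ℚ_[p] (padicCoeffField S)]
  (θ : FramedGaloisRep K (padicCoeffIntegers S) 1)
  {V : WeierstrassCurve K} {j : V.geomPrimaryTorsion p →+ Cofree θ (padicCoeffField S)} {S₀ : Set (HeightOneSpectrum (𝓞 K))} {ε : ℤˣ}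
  (D : SignedTransportDualDataSat κ γ (Cofree θ (padicCoeffField S)) (padicCoeffIntegers S) V j S₀ ε)
  {v : HeightOneSpectrum (𝓞 K)} [DistribMulAction (absoluteGaloisGroup (v.adicCompletion K)) (Cofree θ (padicCoeffField S))]
  [SMulCommClass (absoluteGaloisGroup (v.adicCompletion K)) (padicCoeffIntegers S) (Cofree θ (padicCoeffField S))]
  {γv : absoluteGaloisGroup (v.adicCompletion K)} (DQ : LocalCondDualData κ (Cofree θ (padicCoeffField S)) (padicCoeffIntegers S) V j ε v γv)
  (hres : ∀ (σ : absoluteGaloisGroup (v.adicCompletion K)) (m : Cofree θ (padicCoeffField S)), σ • m = resGalOfEmb (closureEmb (K := K) (v.adicCompletion K)) σ • m)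
  (hvp : (p : 𝓞 K) ∈ v.asIdeal)
  {γB : absoluteGaloisGroup K} {θ' : absoluteGaloisGroup K →ₜ* (padicCoeffIntegers S)ˣ} {P : Set (HeightOneSpectrum (𝓞 K))}
  (I : CycIwasawaCohomologyDataO S κ γB θ' P 1)
  (hstab : ∀ m : Cofree θ (padicCoeffField S),
    IsOpen (MulAction.stabilizer (absoluteGaloisGroup (v.adicCompletion K)) m : Set (absoluteGaloisGroup (v.adicCompletion K))))
  (hθ : ∀ σ : absoluteGaloisGroup K,
    ((θ' σ : (padicCoeffIntegers S)ˣ) : padicCoeffIntegers S) * ((θ σ : GL (Fin 1) (padicCoeffIntegers S)) : Matrix (Fin 1) (Fin 1) (padicCoeffIntegers S)) 0 0 = 1)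
  (htor : ∀ m : Cofree θ (padicCoeffField S), ∃ k : ℕ, p ^ k • m = 0)
  (hγB : γB * resGalOfEmb (closureEmb (K := K) (v.adicCompletion K)) γv ∈ κ.kerSubgroup)
  (hNP : ∀ n, ramificationSubgroup K P ≤ κ.layerSubgroup n) (hv : AcSigned.IsNonsplitIn κ v)

/-- ★★★ **J3 FOR `M = (F/𝒪)(θ)` FROM `RSeq` AND `hsolL`** (`Pk := cofreeCoeffPairing`, p791753): the form to use (supersedes the `R`-form `exists_junction_exact_cofree`).
[cite: Kobayashi2003, Thm. 7.3 i)] [cite: Rubin2000, Thm. 1.7.3, §4.2] [cite: NeukirchSchmidtWingberg2008, VIII §6, (7.2.6)] [cite: Kato2004Asterisque, §17.13] -/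
theorem exists_junction_exact_cofree_seq (instX : Module (IwasawaAlgebraO S) D.X) (instQ : Module (IwasawaAlgebraO S) DQ.X)
    (hιX : ∀ (f : IwasawaAlgebra p) (x : D.X), (letI := instX; iwasawaToIwasawaO S f • x) = f • x)
    (hιQ : ∀ (f : IwasawaAlgebra p) (x : DQ.X), (letI := instQ; iwasawaToIwasawaO S f • x) = f • x)
    (hCX : ∀ (a : padicCoeffIntegers S) (x : D.X) (s : signedTransportSelmerInftySat κ (Cofree θ (padicCoeffField S)) (padicCoeffIntegers S) V j S₀ ε),
      D.toDual (letI := instX; (PowerSeries.C a : IwasawaAlgebraO S) • x) s =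
        D.toDual x ⟨GreenbergSelmer.scalarH1 κ.kerSubgroup (Cofree θ (padicCoeffField S)) a s,
          scalarH1_mem_signedTransportSelmerInftySat κ (Cofree θ (padicCoeffField S)) (padicCoeffIntegers S) V j S₀ ε a s.2⟩)
    (hCQ : ∀ (a : padicCoeffIntegers S) (x : DQ.X) (c : localCondInftySat κ (Cofree θ (padicCoeffField S)) (padicCoeffIntegers S) V j ε v),
      DQ.toDual (letI := instQ; (PowerSeries.C a : IwasawaAlgebraO S) • x) c = DQ.toDual x (scalarLocalSat κ (Cofree θ (padicCoeffField S)) (padicCoeffIntegers S) V j ε v a c))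
    (hstabK : ∀ m : Cofree θ (padicCoeffField S), IsOpen (MulAction.stabilizer (absoluteGaloisGroup K) m : Set (absoluteGaloisGroup K)))
    (hγ : κ.IsTopGenerator γ) (hγv : κ.IsTopGenerator (resGalOfEmb (closureEmb (K := K) (v.adicCompletion K)) γv)) (hP : P.Finite)
    (RSeq : ∀ (n : ℕ) (y : ∀ k : ℕ, cycLayerCohO S κ θ' P n k 1), (∀ k, y k ∈ strictLevel S κ θ' P S₀ n k) →
      (∀ k, cycLayerRedO S κ θ' P n k 1 (y (k + 1)) = y k) →
      ∀ (k : ℕ) (ℓ : subgroupH1 (localSubgroupOfEmb (κ.layerSubgroup n) (closureEmb (K := K) (v.adicCompletion K))) ↥(torsionPow (Cofree θ (padicCoeffField S)) p k))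
        (c : subgroupH1 (κ.layerSubgroup n) (Cofree θ (padicCoeffField S))),
        c ∈ signedTransportSelmerLayerSat κ (Cofree θ (padicCoeffField S)) (padicCoeffIntegers S) V j S₀ ε n →
        torsToH1 (Cofree θ (padicCoeffField S)) p _ k ℓ = locH1Layer κ (Cofree θ (padicCoeffField S)) v hres n c →
        locPairNK S κ θ' P v (Cofree θ (padicCoeffField S)) hstab (cofreeCoeffPairing S θ' P v θ hres hstab hθ) n k (y k) ℓ = 0)
    (hsolL : ∀ q : localCondInftySat κ (Cofree θ (padicCoeffField S)) (padicCoeffIntegers S) V j ε v →+ AddCircle (1 : ℚ),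
      (∀ s : signedTransportSelmerInftySat κ (Cofree θ (padicCoeffField S)) (padicCoeffIntegers S) V j S₀ ε,
        q (locSat κ (Cofree θ (padicCoeffField S)) (padicCoeffIntegers S) V j S₀ ε v hres hvp s) = 0) →
      ∀ m : ℕ, ∃ y ∈ strictLevel S κ θ' P S₀ m m,
        ∀ (ℓ : subgroupH1 (localSubgroupOfEmb (κ.layerSubgroup m) (closureEmb (K := K) (v.adicCompletion K))) ↥(torsionPow (Cofree θ (padicCoeffField S)) p m))
          (hℓ : ℓ ∈ goodLevel S κ v (Cofree θ (padicCoeffField S)) V j ε m m),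
          locPairNK S κ θ' P v (Cofree θ (padicCoeffField S)) hstab (cofreeCoeffPairing S θ' P v θ hres hstab hθ) m m y ℓ = q ⟨_, hℓ⟩) :
    letI := instX; letI := instQ
    ∃ j₀ : strictCarrier I (strictLevel S κ θ' P S₀) (fun n k f _ hy ↦ smul_mem_strictLevel S κ θ' P S₀ γB n k f hy) →ₗ[IwasawaAlgebraO S] DQ.X,
      (∀ b, DQ.toDual (j₀ b) = strictPairing (layerPairingOf S κ θ' P v (Cofree θ (padicCoeffField S)) hstab (cofreeCoeffPairing S θ' P v θ hres hstab hθ) htor γB γv hγB hNP hv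
        (cofreeCoeffPairing_hPred S θ' P v θ hres hstab hθ) (cofreeCoeffPairing_hPsc S θ' P v θ hres hstab hθ)) I (strictLevel S κ θ' P S₀)
        (fun n k f _ hy ↦ smul_mem_strictLevel S κ θ' P S₀ γB n k f hy) hstab b) ∧
      Function.Exact j₀ (gXLinearMapO S D DQ hres hvp instX instQ hιX hιQ hCX hCQ htor hstabK hstab hγ hv hγv) :=
  exists_junction_exact_of_levelwiseSeq S D DQ hres hvp I hstab (cofreeCoeffPairing S θ' P v θ hres hstab hθ) htor hγB hNP hv
    (cofreeCoeffPairing_hPred S θ' P v θ hres hstab hθ) (cofreeCoeffPairing_hPsc S θ' P v θ hres hstab hθ) instX instQ hιX hιQ hCX hCQ hstabK hγ hγv hP RSeq hsolL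

end CofreeSeq


end Summit.BirchSwinnertonDyer.BirchSwinnertonDyer.Theorems.SmallImageRttD2Seq

end
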